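import Literature.AlgebraicGeometry.AbelianSchemes.RigidifiedTrivialFpqcDescent
import HarnessLib

/-!
# A rigidified line bundle on `A_T` which is trivial after a QUASI-COMPACT faithfully flat base change is trivial
# ((u6b) for `[QuasiCompact c]`, by reduction to the affine case along a finite affine subcover)

Layer `Literature/AlgebraicGeometry/AbelianSchemes`, namespace `Literature.AlgebraicGeometry.AbelianSchemes.AbelianSchemeOver`.
THEOREMS ONLY; no definition, no named fact, no instance, no notation, no `sorry`.

★ `RigidifiedTrivialFpqcDescent` proves (u6b) for `c : T₁ → T` AFFINE, flat, surjective; ★ `RigidifiedTrivialOfOpenCover`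
(B-p16 (g14)) proves the Zariski version (open covers of `T`).  Together they give (u6b) for `c` QUASI-COMPACT, flat and
surjective — the natural fpqc hypothesis of [SGA1] VIII 1.1 / [GortzWedhorn2020] Def. 14.67 — WITHOUT the quasi-compact
generalisation of the descent of sections: over an affine open `V ⊆ T` the base change `T₁ ×_T V` is quasi-compact, a
FINITE affine subcover `(W_k)` of it gives the AFFINE faithfully flat `c′ : ∐ₖ W_k → V`, the pull-back of `N|_{A_V}` along
`1_A × c′` is the pull-back of `(1_A × c)^*N ≅ 𝒪` along `1_A × d` (`d : ∐ₖ W_k → T₁`), hence trivial, so `N|_{A_V} ≅ 𝒪` by the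
affine case, and `N ≅ 𝒪` by the Zariski case over `T.affineCover`.

* `nonempty_pullback_prodMap_prodMap_iso_of_sq` — `(1_A × c′)^*(1_A × v)^*F ≅ (1_A × d)^*(1_A × c)^*F` whenever `c′ ≫ v = d ≫ c`;
* **`RigidifiedLineBundle.nonempty_iso_unit_of_pullback_prodMap_of_quasiCompact`** (one-module form, `S` locally
  Noetherian) and **`RigidifiedLineBundle.nonempty_iso_of_pullback_prodMap_of_quasiCompact`** (two-module form).

Cell `hodgecm-mathlib`, HECKE-LINK D6 (u6b), count-neutral capital (B-plan1 (g15) 2026-08-30 01:25Z (3)).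
HC_CM is proved only modulo the 7 printed citations until rung 0 closes; nothing here is about HC.

## References
* [MumfordAV1970] D. Mumford, *Abelian Varieties* (1970), §13 (p. 125), §15 Thm. 1 (p. 143).
* [SGA1] A. Grothendieck, *SGA 1*, Exp. VIII §1, Thm. 1.1, Cor. 1.2.
* [GortzWedhorn2020] U. Görtz, T. Wedhorn, *Algebraic Geometry I*, 2nd ed. (2020), Section (4.7) (pp. 107–108), Prop. 14.66.
-/

noncomputable section

-- `(A.baseChange f).X = (Over.pullback f).obj A.X` holds by `rfl` only; `Scheme.Modules` is not reducible.
set_option backward.isDefEq.respectTransparency false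

universe u

open CategoryTheory CategoryTheory.Limits AlgebraicGeometry TopologicalSpace Opposite
open scoped MonObj

namespace Literature.AlgebraicGeometry.AbelianSchemes

namespace AbelianSchemeOver

open Literature.AlgebraicGeometry.Modules Literature.AlgebraicGeometry.Motives

variable {S : Scheme.{u}} (A : AbelianSchemeOver S)

/-! ## §1 Transport of a pull-back along a commuting square of test schemes -/

/-- **`(1_A × c′)^*(1_A × v)^*F ≅ (1_A × d)^*(1_A × c)^*F` when `c′ ≫ v = d ≫ c`** (both are `(1_A × (c′ ≫ v))^*F`, ★
`prodMap_comp`). [cite: GortzWedhorn2020, Section (4.7) (pp. 107–108)] -/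
theorem nonempty_pullback_prodMap_prodMap_iso_of_sq {T T₁ V Z : Scheme.{u}} (f : T ⟶ S) (c : T₁ ⟶ T) (v : V ⟶ T)
    (c' : Z ⟶ V) (d : Z ⟶ T₁) (hsq : c' ≫ v = d ≫ c) (F : (A.baseChange f).X.left.Modules) :
    Nonempty ((Scheme.Modules.pullback (A.prodMap (c' ≫ v ≫ f) (v ≫ f) c' rfl)).obj
        ((Scheme.Modules.pullback (A.prodMap (v ≫ f) f v rfl)).obj F) ≅
      (Scheme.Modules.pullback (A.prodMap (c' ≫ v ≫ f) (c ≫ f) d (by rw [← Category.assoc, ← hsq, Category.assoc]))).obj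
        ((Scheme.Modules.pullback (A.prodMap (c ≫ f) f c rfl)).obj F)) := by
  have hd : d ≫ c ≫ f = c' ≫ v ≫ f := by rw [← Category.assoc, ← hsq, Category.assoc]
  have h₁ : A.prodMap (c' ≫ v ≫ f) (v ≫ f) c' rfl ≫ A.prodMap (v ≫ f) f v rfl =
      A.prodMap (c' ≫ v ≫ f) (c ≫ f) d hd ≫ A.prodMap (c ≫ f) f c rfl := by
    rw [prodMap_comp, prodMap_comp]
    exact A.prodMap_congr _ _ hsq _ _
  exact ⟨(Scheme.Modules.pullbackComp _ _).app F ≪≫ (Scheme.Modules.pullbackCongr h₁).app F ≪≫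
    ((Scheme.Modules.pullbackComp _ _).app F).symm⟩

/-! ## §2 The quasi-compact case -/

namespace RigidifiedLineBundle

variable {A}

/-- **(u6b) for a QUASI-COMPACT faithfully flat base change** (over a locally Noetherian `S`): if a rigidified line
bundle `N` on `A_T` becomes trivial on `A_{T₁}` for `c : T₁ → T` quasi-compact, flat and surjective, then `N ≅ 𝒪`.  Over
each affine `V` of `T.affineCover`, a finite affine subcover `W` of the quasi-compact `T₁ ×_T V` gives the AFFINE
faithfully flat `c′ : ∐ W → V` (Mathlib: finite coproducts of affines are affine, `Flat (Sigma.desc _)`,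
`Surjective (Sigma.desc _)` for a cover), `(1_A × c′)^*(N|_{A_V}) ≅ (1_A × d)^*(1_A × c)^*N ≅ 𝒪`, so `N|_{A_V} ≅ 𝒪` by ★
`nonempty_iso_unit_of_pullback_prodMap_of_isLocallyNoetherian'`, and `N ≅ 𝒪` by ★
`nonempty_iso_unit_of_openCover_of_isLocallyNoetherian`. [cite: MumfordAV1970, §13 (p. 125), §15 Thm. 1 (p. 143)]
[cite: SGA1, Exp. VIII Thm. 1.1, Cor. 1.2] -/
theorem nonempty_iso_unit_of_pullback_prodMap_of_quasiCompact [IsLocallyNoetherian S] {T₁ T : Scheme.{u}}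
    (f : T ⟶ S) (c : T₁ ⟶ T) [QuasiCompact c] [Flat c] [Surjective c] (N : A.RigidifiedLineBundle f)
    (h : Nonempty ((Scheme.Modules.pullback (A.prodMap (c ≫ f) f c rfl)).obj N.L ≅ SheafOfModules.unit _)) :
    Nonempty (N.L ≅ SheafOfModules.unit _) := by
  obtain ⟨φ⟩ := h
  refine nonempty_iso_unit_of_openCover_of_isLocallyNoetherian N T.affineCover fun i => ?_
  -- the affine open `V = T.affineCover.X i` and the quasi-compact `T₁ ×_T V`
  set V := T.affineCover.X i with hV
  set v : V ⟶ T := T.affineCover.f i with hv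
  haveI : IsAffine V := by rw [hV]; infer_instance
  haveI : CompactSpace ↥(pullback c v) := QuasiCompact.compactSpace_of_compactSpace (pullback.snd c v)
  -- a finite affine subcover `W` of `T₁ ×_T V` and the affine faithfully flat `c′ : ∐ W → V`
  let 𝒲 := (pullback c v).affineCover.finiteSubcover
  haveI : ∀ k, IsAffine (𝒲.X k) := fun k => by
    change IsAffine ((pullback c v).affineCover.X _)
    infer_instance
  let c' : (∐ 𝒲.X) ⟶ V := Sigma.desc (fun k => 𝒲.f k) ≫ pullback.snd c v
  let d : (∐ 𝒲.X) ⟶ T₁ := Sigma.desc (fun k => 𝒲.f k) ≫ pullback.fst c v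
  have hsq : c' ≫ v = d ≫ c := by
    change (Sigma.desc (fun k => 𝒲.f k) ≫ pullback.snd c v) ≫ v = (Sigma.desc (fun k => 𝒲.f k) ≫ pullback.fst c v) ≫ c
    rw [Category.assoc, Category.assoc, pullback.condition]
  haveI : Flat c' := inferInstance
  haveI : Surjective c' := inferInstance
  haveI : IsAffineHom c' := inferInstance
  -- `(1_A × c′)^* (N|_{A_V}) ≅ (1_A × d)^* (1_A × c)^* N ≅ 𝒪`
  obtain ⟨e₁⟩ := A.nonempty_pullback_prodMap_prodMap_iso_of_sq f c v c' d hsq N.L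
  have htriv : Nonempty ((Scheme.Modules.pullback (A.prodMap (c' ≫ v ≫ f) (v ≫ f) c' rfl)).obj
      (N.comapAlong v rfl).L ≅ SheafOfModules.unit _) :=
    ⟨e₁ ≪≫ (Scheme.Modules.pullback _).mapIso φ ≪≫ pullbackUnitIso _⟩
  exact nonempty_iso_unit_of_pullback_prodMap_of_isLocallyNoetherian' (v ≫ f) c' (N.comapAlong v rfl) htriv

/-- **Two-module form of (u6b) for a QUASI-COMPACT faithfully flat base change** (over a locally Noetherian `S`):
rigidified `M₁`, `M₂` on `A_T` with `(1_A × c)^*M₁ ≅ (1_A × c)^*M₂` for `c` quasi-compact, flat, surjective are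
isomorphic (same reduction; Zariski step ★ `nonempty_iso_of_openCover_of_isLocallyNoetherian`, affine step ★
`nonempty_iso_of_pullback_prodMap_of_isLocallyNoetherian`). [cite: MumfordAV1970, §13 (p. 125), §15 Thm. 1 (p. 143)]
[cite: SGA1, Exp. VIII Thm. 1.1, Cor. 1.2] -/
theorem nonempty_iso_of_pullback_prodMap_of_quasiCompact [IsLocallyNoetherian S] {T₁ T : Scheme.{u}}
    (f : T ⟶ S) (c : T₁ ⟶ T) [QuasiCompact c] [Flat c] [Surjective c] (M₁ M₂ : A.RigidifiedLineBundle f)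
    (h : Nonempty ((Scheme.Modules.pullback (A.prodMap (c ≫ f) f c rfl)).obj M₁.L ≅
      (Scheme.Modules.pullback (A.prodMap (c ≫ f) f c rfl)).obj M₂.L)) :
    Nonempty (M₁.L ≅ M₂.L) := by
  obtain ⟨φ⟩ := h
  refine nonempty_iso_of_openCover_of_isLocallyNoetherian M₁ M₂ T.affineCover fun i => ?_
  set V := T.affineCover.X i with hV
  set v : V ⟶ T := T.affineCover.f i with hv
  haveI : IsAffine V := by rw [hV]; infer_instance
  haveI : CompactSpace ↥(pullback c v) := QuasiCompact.compactSpace_of_compactSpace (pullback.snd c v)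
  let 𝒲 := (pullback c v).affineCover.finiteSubcover
  haveI : ∀ k, IsAffine (𝒲.X k) := fun k => by
    change IsAffine ((pullback c v).affineCover.X _)
    infer_instance
  let c' : (∐ 𝒲.X) ⟶ V := Sigma.desc (fun k => 𝒲.f k) ≫ pullback.snd c v
  let d : (∐ 𝒲.X) ⟶ T₁ := Sigma.desc (fun k => 𝒲.f k) ≫ pullback.fst c v
  have hsq : c' ≫ v = d ≫ c := by
    change (Sigma.desc (fun k => 𝒲.f k) ≫ pullback.snd c v) ≫ v = (Sigma.desc (fun k => 𝒲.f k) ≫ pullback.fst c v) ≫ c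
    rw [Category.assoc, Category.assoc, pullback.condition]
  haveI : Flat c' := inferInstance
  haveI : Surjective c' := inferInstance
  haveI : IsAffineHom c' := inferInstance
  obtain ⟨e₁⟩ := A.nonempty_pullback_prodMap_prodMap_iso_of_sq f c v c' d hsq M₁.L
  obtain ⟨e₂⟩ := A.nonempty_pullback_prodMap_prodMap_iso_of_sq f c v c' d hsq M₂.L
  have hiso : Nonempty ((Scheme.Modules.pullback (A.prodMap (c' ≫ v ≫ f) (v ≫ f) c' rfl)).obj (M₁.comapAlong v rfl).L ≅
      (Scheme.Modules.pullback (A.prodMap (c' ≫ v ≫ f) (v ≫ f) c' rfl)).obj (M₂.comapAlong v rfl).L) :=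
    ⟨e₁ ≪≫ (Scheme.Modules.pullback _).mapIso φ ≪≫ e₂.symm⟩
  exact nonempty_iso_of_pullback_prodMap_of_isLocallyNoetherian_of_isPullback (v ≫ f) c' (pullback.fst c' c')
    (pullback.snd c' c') (IsPullback.of_hasPullback c' c') (M₁.comapAlong v rfl) (M₂.comapAlong v rfl) hiso

end RigidifiedLineBundle

end AbelianSchemeOver

end Literature.AlgebraicGeometry.AbelianSchemes

end
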